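import Literature.AlgebraicGeometry.HodgeTheory.BlochSemiregularSpreadGlobal
import Literature.AlgebraicGeometry.HodgeTheory.BlochSemiregularityTheorem
import Literature.AlgebraicGeometry.HodgeTheory.SemiregularVariationalHodgeISemiregular
import Literature.AlgebraicGeometry.HodgeTheory.SemiregularVariationalHodgeProofs
import Literature.AlgebraicGeometry.HodgeTheory.AlgebraicClassesHodgeTypeHolds
import Literature.AlgebraicGeometry.HodgeTheory.HodgeTypeConjugation
import Literature.NumberTheory.Transcendental.AnalytificationConnectedProofs
import HarnessLib

/-!
# Venture HSemireg — the semiregularity theorems AS PRINTED (Bloch 1972; Buchweitz–Flenner 2003),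
# indexed in the venture namespace, and their GLOBAL forms proved from the tree's named facts

HONEST FRAMING. Interface/index file of the computation cell `pub-hsemireg` (theory seat th-1). It makes NO
claim about any explicit variety and proves NO case of the Hodge conjecture. It records, statement-exact with
page/line locators, the two published transfer theorems the cell's chain «semiregular representative at ONE
point `s₀` of a family ⇒ the class is algebraic on EVERY member of the (irreducible) family» rests on, points
each printed statement to the tree's rendering on REAL carriers (all in `Literature/AlgebraicGeometry/
HodgeTheory/`, none re-declared here), and PROVES the two global forms the chain consumes from existing named
facts of the tree (supplied as explicit hypotheses; nothing new is assumed, no new named fact is minted).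
There is NO `def … : Prop` in this file: every declaration is a kernel-checked `theorem` whose hypotheses
name the tree's facts it rests on (so a consumer's trust base is literally those Literature facts, and no
statement is vendored or relocated).

## Sources (page/line of the PRINTED pages; verbatim texts with the same locators are in the theorem docstrings
## below and in the cell's typed files `run/shared/lean/pub/pub-hsemireg/lit/Bloch1972.md`, `…/BuchweitzFlenner2003.md`,
## cross-read against the page images `…/lit/Bloch1972-Invent17-GDZ/img_pNNN.jpg` by the cell's referee, LIT-CHECK-1.md)

S. Bloch, *Semi-regularity and de Rham cohomology*, Invent. Math. 17 (1972) 51–66.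
* p. 51 §0 lines 1–4, 8–9 (setting: `X` smooth projective over `ℂ`, `Z ⊂ X` an lci subscheme of codimension
  `p`; "`Z` is said to be semi-regular if `π` is injective"); p. 52 §1 lines 9–21 (`π` := Grothendieck dual of
  `Λ^{p-1}ε : H^{n-p-1}(X, Ω^{n-p+1}_X) → H^{n-p-1}(Z, ω_Z ⊗ N^*)`) — TREE: `IsBlochSemiregular i n p`
  (`BlochSemiregularityMapReal.lean`) = SURJECTIVITY of `Λ^{p-1}ε` (Serre-dual form; `π = τ_B = τ` by BF (8.1) /
  Prop. 8.2, pp. 199–200, so "Bloch-semiregular" = BF's "`{p}`-semiregular" for an lci of codimension `p`).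
* p. 64 (7.1) lines 17–22 (object level over `Spec ℂ[[t]]`: "Then `Z₀` lifts to a subscheme `Z ⊂ X`") with the
  proof of (7.4), p. 65 (Artin ⇒ analytic neighbourhood) — TREE: named fact `Bloch1972_semiregularSubschemeLifts`
  (`BlochSemiregularityTheorem.lean`; étale-local; class hypothesis COMPONENTWISE, Scope (R2)); consumed by name,
  not re-declared. p. 64 (7.3) lines 31–33 (`Hilb` smooth at `[Z]`) — no carrier in the tree, not needed.
* p. 65 (7.4) lines 9–14 ("Then for all `s ∈ S`, `z_s ∈ H^{2p}_{DR}(X_s/ℂ)` is algebraic") and the last paragraph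
  of its proof ("`T = {s ∈ S | z_s is algebraic}` is contained in a countable union of closed subvarieties of
  `S`. Since `U ⊂ T`, it follows that `T = S`") — TREE: LOCAL form = named fact `BlochSemiregularSpread n p`
  (`BlochSemiregularSpread.lean`, = BF Thm. 5.2 at `I = {p}`), countable union = named fact
  `charlesSchnell_algebraicityLocus_iUnion_closed` (`AlgebraicityLocus.lean`), GLOBAL form = lit-1's
  `BlochSemiregularSpread.forall_mem_algebraicClasses` (`BlochSemiregularSpreadGlobal.lean`). HERE:
  `Bloch1972.theorem74`.
* p. 65 (7.5) lines 29–35 ("there exist integers `a, b`, `a ≠ 0`, such that `a z₀ + b l₀^p` is the class of a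
  subscheme `Z₀ ⊂ X₀` which is semi-regular and a local complete intersection") — HERE:
  `Bloch1972.semiregular_deforms`, proved from `theorem74` by the printed one-line argument.

R.-O. Buchweitz, H. Flenner, *A semiregularity map for modules and applications to deformations*, Compositio
Math. 137 (2003) 135–210 (= arXiv:math/9912245, same numbering).
* p. 165 §4.1 lines 1–6 (perfect complexes, trace `Tr : Ext^k_X(F, F ⊗^L G) → H^k(X, G)`), p. 166 Def. 4.1 lines
  5–20 (`σ := Tr(∗ · exp(−At(F))) : Ext²_X(F, F) → ∏_k H^{k+2}(X, Λ^k 𝕃_{X/Y})`) — TREE, for a FINITE LOCALLY FREE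
  `F` on a scheme only: `sigmaZero`, `sigmaOne` (`AtiyahClassTraceReal.lean`), `sigmaHigher q`,
  `IsISemiregular hF I` (`SemiregularityHigherSigma.lean`, `I` = FORM degrees); no carrier for coherent
  non-locally-free `F` or perfect complexes (Scope (R4), (R7)).
* p. 174 lines 23–55 ("algebraic", "horizontal", "`I`-semiregular": "the part of the semiregularity map
  `σ_I : Ext²_{X₀}(ℰ₀, ℰ₀) → ∏_{p∈I} H^{p+1}(X₀, Ω^{p−1}_{X₀})` is injective"), Thm. 5.1 p. 174 line 56 – p. 175
  line 4 ("then `α_p(s) ∈ H^p(X_s, Ω^p_{X_s})` is algebraic for all `s ∈ S` near `0` and each `p ∈ I`").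
  INDEX CONVENTION: BF §5 indexes by the CHERN degree `p` (component `σ_{p−1}`); the tree by the FORM degree
  `q = p − 1`: "`I`-semiregular" = `IsISemiregular hE₀ {q | q + 1 ∈ I}`. — TREE: named fact
  `BuchweitzFlenner2003_variationalHodge_ISemiregular` (`SemiregularVariationalHodgeISemiregular.lean`: `ℰ₀`
  FINITE LOCALLY FREE — printed: coherent; local, "near `0`"). HERE: `BuchweitzFlenner2003.semiregular_deforms`
  (its GLOBAL form along an irreducible base).
* p. 175 lines 5–17, Thm. 5.2 (`I`-semiregular SUBSPACES via `τ` on `T²_{Z₀/X₀}(𝒪_{Z₀})`, "generalizes a result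
  of S. Bloch") — at `I = {p}` for an lci this is `BlochSemiregularSpread`; non-lci: no carrier (Scope (R3)).

## Scope — what the printed theorems cover and the tree does NOT (representative classes of the cell)

(R1) integral lci `Z₀`, Bloch-semiregular: COVERED — `BlochSemiregularSpread` (local), `Bloch1972.theorem74` /
`.semiregular_deforms` below (global, proved modulo the two facts). (R2) reducible / non-reduced lci `Z₀`
(Bloch allows any lci subscheme; e.g. Schoen's `Δ ∪ C×C`) where only the TOTAL class `a z₀ + b l₀ᵖ = [Z₀]`
stays Hodge: NOT covered — `BlochSemiregularSpread` asks `Z` integral (so that "supported on `Z`" pins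
`x = μ·cl Z`), `Bloch1972_semiregularSubschemeLifts` asks EACH component's class to stay Hodge; a faithful
rendering needs the fundamental class `[Z₀] = Σ m_K cl(K)` of a pure-codimension subscheme (in progress, seat
lit-1). (R3) arbitrary closed subspaces, `I`-semiregular via `τ` on `T²_{Z₀/X₀}(𝒪_{Z₀})` (BF Thm. 5.2 in
full): no carrier. (R4) COHERENT, not locally free `ℰ₀` (BF Thm. 5.1 as printed; Markman's reflexive secant
sheaves): not rendered — the tree's `σ` needs a finite locally free `ℰ₀`. (R5) finite locally free `ℰ₀`:
COVERED — local fact `BuchweitzFlenner2003_variationalHodge_ISemiregular`, global form proved below.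
(R6) TWISTED sheaves (`B`-fields): not in BF 2003 at all (Markman arXiv:2502.03415 §7.3 Conj. 7.3.9 reduces his
case to 5.1; Perry arXiv:2604.00511 Thm. 1.1 — tree CLAIM-facts `Perry2026_*`, finite locally free only).
(R7) PERFECT COMPLEXES: BF print only Def. 4.1 / Prop. 4.2 / Cor. 4.8 for them, NOT Thm. 5.1 (printed for
coherent sheaves; Prop. 5.9 for "a coherent `S`-flat sheaf"); the complex case is Pridham 2024 / Perry 2026 and
has no carrier in the tree (`σ` of a complex) — a transfer "fact" taking `σ` as unconstrained data would be
the variational Hodge conjecture in disguise and is deliberately NOT stated.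

## What is proved here (trust base = the named facts taken as hypotheses, all pre-existing in the tree)

* `Bloch1972.theorem74 (hB : BlochSemiregularSpread n p) (hCS : charlesSchnell_algebraicityLocus_iUnion_closed)
  …` — (7.4) global (the tree's `BlochSemiregularSpread.forall_mem_algebraicClasses` in Bloch's binder order).
* `Bloch1972.semiregular_deforms (hB) (hCS) …` — (7.4) + (7.5) global ((7.5) from (7.4), as printed).
* `BuchweitzFlenner2003.semiregular_deforms (hBF : BuchweitzFlenner2003_variationalHodge_ISemiregular) (hCS) …`
  — Thm. 5.1 made GLOBAL along an irreducible smooth quasi-projective base for classes that are restrictions of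
  global classes (Ehresmann `isCohomologicallyLocallyTrivialOn_univ_of_isSmoothProjectiveFamily`, flatness of
  restricted global classes `transportFun_map_fiberι`, the path component of `s₀` in BF's neighbourhood, and
  Bloch's last paragraph `charlesSchnell_algebraicityLocus_iUnion_closed.forall_mem_algebraicClasses_of_isOpen`).
How the cell's chain uses them: th-3's `TransferChain.lean` takes `hB`/`hBF` and `hCS` as hypotheses and calls
these theorems; the engines' certificates (`Certificate.lean`) supply `IsBlochSemiregular i n p`.

## References

* [Bloch1972Semiregularity] S. Bloch, Invent. Math. 17 (1972) 51–66: §0 p. 51, §1 p. 52, (7.1) and (7.3)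
  p. 64, (7.4) and (7.5) p. 65.
* [BuchweitzFlenner2003] R.-O. Buchweitz, H. Flenner, Compositio Math. 137 (2003) 135–210: §4.1 p. 165,
  Def. 4.1 p. 166, §5 and Thm. 5.1/5.2 pp. 174–175, (8.1)–Prop. 8.2 pp. 199–200.
* [CharlesSchnell2014Notes] F. Charles, C. Schnell, Notes on absolute Hodge classes, proof of Prop. 11.3.11.
* [Artin1969] M. Artin, Publ. Math. IHÉS 36 (1969), Cor. (2.2).
-/

noncomputable section

open CategoryTheory AlgebraicGeometry Set
open Literature.AlgebraicGeometry.HodgeTheory Literature.AlgebraicGeometry.Motives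
open Literature.AlgebraicTopology.SingularHomology

namespace Summit.Ventures.HSemireg

local notation3 (prettyPrint := false) "Res[" f ", " s ", " k ", " A "]" =>
  complexBetti.map (Literature.AlgebraicGeometry.Motives.fiberι f s) k A

/-! ## Bloch 1972 -/

namespace Bloch1972

variable {n p : ℕ}

/-- **Bloch 1972, Thm. (7.4) (p. 65, lines 9–14), class level, GLOBAL over the connected base — a theorem
modulo the tree's named facts `BlochSemiregularSpread n p` and `charlesSchnell_algebraicityLocus_iUnion_closed`.**
Printed: "Let `X →ᶠ S →ᵍ Spec(ℂ)` be morphisms, with `f` smooth and projective and `g` smooth, connected, and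
of finite type. Let `z ∈ Γ(S, R^{2p} f_*(Ω•_{X/S}))` be a horizontal section and let `o ∈ S`. Suppose the
restricted class `z₀ ∈ H^{2p}_{DR}(X₀/ℂ)` is algebraic, representing a local complete intersection,
`Z₀ ⊂ X₀` which is semi-regular in `X₀`. Then for all `s ∈ S`, `z_s ∈ H^{2p}_{DR}(X_s/ℂ)` is algebraic."
RENDERING = the binders of the tree's named fact `BlochSemiregularSpread n p` (dictionary (D1)–(D5) in the
module docstring of `BlochSemiregularSpread.lean`): "`f` smooth and projective" = `IsSmoothProjectiveFamily f n`
with `𝒳`, `S` quasi-projective; "`g` smooth, connected, of finite type" = `S` smooth and IRREDUCIBLE (a smooth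
connected scheme of finite type over a field is irreducible; irreducibility is what the last paragraph uses);
"`z` horizontal" = a global class `W ∈ H^{2p}(𝒳(ℂ); ℂ)` with fibre restrictions rational of type `(p,p)` (Bloch
derives `F^p` from Deligne; assumed here, true on a Hodge-locus component by definition); "`Z₀` a local
complete intersection which is semi-regular" = an INTEGRAL `i : Z ↪ X₀ ≅ 𝒳_{s₀}` with
`IsRegularImmersionOfCodim i p`, `IsBlochSemiregular i n p`; "`z₀` algebraic, representing `Z₀`" = `e^*(W|_{s₀})`
is a class supported on `Z` (`= μ·cl Z`, purity); "for all `s ∈ S`, `z_s` is algebraic" = `W|_{𝒳_t} ∈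
algebraicClasses (𝒳_t) p` for every `t ∈ S(ℂ)`. Scope: integral `Z` only ((R2)). Proof = Bloch's: the local fact
gives an open `U ∋ s₀` of algebraicity and Bloch's last paragraph
(`charlesSchnell_algebraicityLocus_iUnion_closed.forall_mem_algebraicClasses_of_isOpen`, Baire on `S(ℂ)`) spreads
it — this is lit-1's `BlochSemiregularSpread.forall_mem_algebraicClasses` in Bloch's binder order. Trust base:
exactly `hB`, `hCS`.
[cite: Bloch1972Semiregularity, Thm. (7.4) p. 65 and the last paragraph of its proof]
[cite: BuchweitzFlenner2003, Thm. 5.2 p. 175 (local form) and (8.1)–Prop. 8.2 pp. 199–200]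
[cite: CharlesSchnell2014Notes, Prop. 11.3.11 (proof)] -/
theorem theorem74 (hB : BlochSemiregularSpread n p) (hCS : charlesSchnell_algebraicityLocus_iUnion_closed)
    -- "`f` smooth and projective", "`g` smooth, connected, and of finite type"
    {𝒳 S : SchemeOver ℂ} (f : 𝒳 ⟶ S) (hf : IsSmoothProjectiveFamily f n) (h𝒳 : IsQuasiProjectiveOver 𝒳)
    (hS : IsQuasiProjectiveOver S) (hSm : AlgebraicGeometry.Smooth S.hom) [IrreducibleSpace S.left]
    -- "`z` a horizontal section", a rational class of Hodge type `(p,p)` on every fibre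
    (W : complexBetti 𝒳 (2 * p))
    (hW : ∀ s : ComplexPoints S, IsRationalClass (Res[f, s, 2 * p, W]) ∧
      IsOfHodgeType n (fiberOver f s) (2 * p) p p (Res[f, s, 2 * p, W]))
    -- "let `o ∈ S`", the fibre `X₀`
    (s₀ : ComplexPoints S) (X₀ : SchemeOver ℂ) (e : X₀ ≅ fiberOver f s₀)
    -- "a local complete intersection `Z₀ ⊂ X₀`" of codimension `p` (integral: the tree's rendering)
    (Z : Scheme.{0}) (i : Z ⟶ X₀.left) (hi : IsClosedImmersion i) (hreg : IsRegularImmersionOfCodim i p)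
    (hZ : AlgebraicGeometry.IsIntegral Z) (hcodim : ∀ z ∈ Set.range i.base, (p : ℕ∞) ≤ Order.coheight z)
    -- "which is semi-regular in `X₀`"
    (hsr : IsBlochSemiregular i n p)
    -- "`z₀` is algebraic, representing `Z₀`": the value of `z` at `s₀` is a class supported on `Z₀`
    (x : complexBetti X₀ (2 * p)) (hx : x ∈ classesSupportedOn X₀ (Set.range i.base) (2 * p))
    (hWx : complexBetti.map e.hom (2 * p) (Res[f, s₀, 2 * p, W]) = x)
    -- "Then for all `s ∈ S`, `z_s` is algebraic."
    (t : ComplexPoints S) : Res[f, t, 2 * p, W] ∈ algebraicClasses (fiberOver f t) p := by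
  obtain ⟨U, hU, hs₀, hUA⟩ := hB X₀ Z i x 𝒳 S f s₀ e W hi hreg hZ hcodim hsr hx hf h𝒳 hS hSm hW hWx
  exact hCS.forall_mem_algebraicClasses_of_isOpen f n p h𝒳 hS hSm hf W hU ⟨s₀, hs₀⟩ hUA t

/-- **Bloch 1972, Thm. (7.4) with the weakening of Remark (7.5) (p. 65, lines 29–35) — "a semiregular
representative deforms the class", a theorem modulo the same two named facts.** Printed (7.5): "Let
`l ∈ Γ(S, R² f_*(Ω•))` be the polarization class. The hypothesis on `z₀` in (7.4) can be weakened to read: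
there exist integers `a, b`, `a ≠ 0`, such that `a z₀ + b l₀^p` is the class of a subscheme `Z₀ ⊂ X₀` which
is semi-regular and a local complete intersection." RENDERING: as `theorem74`, with the class hypothesis
replaced by: an integer `a ≠ 0` and a global class `A ∈ H^{2p}(𝒳(ℂ); ℂ)` whose fibre restrictions are
RATIONAL and ALGEBRAIC on every fibre (the printed instance is `A = b·lᵖ`, `l` the polarization class: an
integral class, algebraic as a power of a divisor class) such that `e^*((a•W + A)|_{𝒳_{s₀}}) = x` is
supported on the integral Bloch-semiregular local complete intersection `Z ↪ X₀` of codimension `p`;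
conclusion: `W|_{𝒳_t}` is algebraic for EVERY `t ∈ S(ℂ)`. Proof, as printed: apply (7.4) to the horizontal
class `a z + A` — a rational Hodge class on every fibre (algebraic classes are of type `(p,p)`), whose value
at `s₀` is the class of the semiregular `Z₀` — and subtract the algebraic class `A_s`, `a ≠ 0` (allowing any
such `A` instead of `b·lᵖ` is this very argument). This is the form the cell's transfer chain consumes («HC
at the CM point makes `a z₀ + b l₀ᵖ` effective; semiregular there ⇒ `z_s` algebraic on the whole
component»). Scope: integral `Z` only ((R2)). Trust base: `hB`, `hCS`.
[cite: Bloch1972Semiregularity, Remark (7.5) and Thm. (7.4), p. 65]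
[cite: CharlesSchnell2014Notes, Prop. 11.3.11 (proof)] -/
theorem semiregular_deforms (hB : BlochSemiregularSpread n p)
    (hCS : charlesSchnell_algebraicityLocus_iUnion_closed)
    {𝒳 S : SchemeOver ℂ} (f : 𝒳 ⟶ S) (hf : IsSmoothProjectiveFamily f n) (h𝒳 : IsQuasiProjectiveOver 𝒳)
    (hS : IsQuasiProjectiveOver S) (hSm : AlgebraicGeometry.Smooth S.hom) [IrreducibleSpace S.left]
    -- `z`: horizontal, a rational Hodge class on every fibre
    (W : complexBetti 𝒳 (2 * p))
    (hW : ∀ s : ComplexPoints S, IsRationalClass (Res[f, s, 2 * p, W]) ∧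
      IsOfHodgeType n (fiberOver f s) (2 * p) p p (Res[f, s, 2 * p, W]))
    -- `b·lᵖ`: a global class, rational and algebraic on every fibre
    (A : complexBetti 𝒳 (2 * p))
    (hA : ∀ s : ComplexPoints S, IsRationalClass (Res[f, s, 2 * p, A]) ∧
      Res[f, s, 2 * p, A] ∈ algebraicClasses (fiberOver f s) p)
    (a : ℤ) (ha : a ≠ 0)
    (s₀ : ComplexPoints S) (X₀ : SchemeOver ℂ) (e : X₀ ≅ fiberOver f s₀)
    (Z : Scheme.{0}) (i : Z ⟶ X₀.left) (hi : IsClosedImmersion i) (hreg : IsRegularImmersionOfCodim i p)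
    (hZ : AlgebraicGeometry.IsIntegral Z) (hcodim : ∀ z ∈ Set.range i.base, (p : ℕ∞) ≤ Order.coheight z)
    (hsr : IsBlochSemiregular i n p)
    -- "`a z₀ + b l₀ᵖ` is the class of" the semiregular local complete intersection `Z₀`
    (x : complexBetti X₀ (2 * p)) (hx : x ∈ classesSupportedOn X₀ (Set.range i.base) (2 * p))
    (hWAx : complexBetti.map e.hom (2 * p) (Res[f, s₀, 2 * p, (a : ℂ) • W + A]) = x)
    (t : ComplexPoints S) : Res[f, t, 2 * p, W] ∈ algebraicClasses (fiberOver f t) p := by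
  -- fibre restrictions of `W' := a•W + A`
  have hres : ∀ s : ComplexPoints S,
      Res[f, s, 2 * p, (a : ℂ) • W + A] = (a : ℂ) • Res[f, s, 2 * p, W] + Res[f, s, 2 * p, A] := by
    intro s
    rw [map_add, map_smul]
  -- `W'` is fibrewise rational of type `(p,p)` (algebraic classes are of type `(p,p)`)
  have hW'H : ∀ s : ComplexPoints S, IsRationalClass (Res[f, s, 2 * p, (a : ℂ) • W + A]) ∧
      IsOfHodgeType n (fiberOver f s) (2 * p) p p (Res[f, s, 2 * p, (a : ℂ) • W + A]) := by
    intro s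
    rw [hres]
    have hrat : IsRationalClass ((a : ℂ) • Res[f, s, 2 * p, W]) := by
      have h := (hW s).1.smul (a : ℚ)
      rwa [Rat.cast_intCast] at h
    exact ⟨hrat.add (hA s).1,
      ((hW s).2.smul (a : ℂ)).add (hf.isSmoothProjective s)
        (isOfHodgeType_of_mem_algebraicClasses_of_isSmoothProjective (hf.isSmoothProjective s) p
          (hA s).2)⟩
  -- (7.4) for `W'`: algebraic on every fibre
  have halg := theorem74 hB hCS f hf h𝒳 hS hSm ((a : ℂ) • W + A) hW'H s₀ X₀ e Z i hi hreg hZ hcodim hsr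
    x hx hWAx t
  rw [hres] at halg
  -- subtract `A|_{𝒳_t}` and divide by `a`
  have ha' : (a : ℂ) ≠ 0 := Int.cast_ne_zero.mpr ha
  have hsmul : (a : ℂ) • Res[f, t, 2 * p, W] ∈ algebraicClasses (fiberOver f t) p := by
    have h := Submodule.sub_mem _ halg (hA t).2
    rwa [add_sub_cancel_right] at h
  have h := Submodule.smul_mem _ (a : ℂ)⁻¹ hsmul
  rwa [smul_smul, inv_mul_cancel₀ ha', one_smul] at h

/-! (7.1), object level (p. 64, lines 17–22: "Then `Z₀` lifts to a subscheme `Z ⊂ X`"; proof of (7.4),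
p. 65: "By a theorem of Artin [1], the existence of `Z̄` implies that `Z₀` extends to an analytic map
`Z : U → H`") is the tree's named fact `Bloch1972_semiregularSubschemeLifts`
(`BlochSemiregularityTheorem.lean`: étale neighbourhood of `s₀`, flat closed `𝒵 ⊆ 𝒳 ×_S V` with fibre
`Z₀`; class hypothesis rendered COMPONENTWISE — Scope (R2)); it is consumed BY NAME and not re-declared here.
(7.3) (p. 64: "`Z ∈ Hilb(X/ℂ)` is smooth") has no carrier in the tree. -/

end Bloch1972

/-! ## Buchweitz–Flenner 2003 -/

namespace BuchweitzFlenner2003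

variable {n : ℕ}

/-! Thm. 5.1 LOCAL form ("for all `s ∈ S` near `0`", p. 174 line 56 – p. 175 line 4) is the tree's named fact
`BuchweitzFlenner2003_variationalHodge_ISemiregular` (`SemiregularVariationalHodgeISemiregular.lean`), with
the printed Chern-degree index set `I` rendered as the FORM degrees `{q | q + 1 ∈ I}` of the tree's `σ_q`
(`IsISemiregular hE₀ {q | q + 1 ∈ I}`; BF §5 "`p`-semiregular" ⟺ `σ_{p−1}` injective), `ℰ₀` FINITE LOCALLY
FREE (printed: coherent — Scope (R4)); consumed BY NAME below. -/

/-- **Buchweitz–Flenner 2003, Thm. 5.1, GLOBAL form along an irreducible base — "the partial Chern character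
of an `I`-semiregular vector bundle stays algebraic on EVERY fibre", a theorem modulo the tree's named facts
`BuchweitzFlenner2003_variationalHodge_ISemiregular` and `charlesSchnell_algebraicityLocus_iUnion_closed`.**
Printed (p. 174 line 56 – p. 175 line 4): "Let `π : X → S` be a deformation of a compact complex algebraic
manifold `X₀` over a smooth germ `S = (S, 0)` […]. Assume that `(α_p)_{p∈I}` is a horizontal section in
`∏_{p∈I} R^p π_*(Ω^p_{X/S})`. If there is an `I`-semiregular sheaf `ℰ₀` on `X₀` with `α_p(0) = ch_p(ℰ₀)`,
`p ∈ I`, then `α_p(s)` is algebraic for all `s ∈ S` near `0` and each `p ∈ I`", with (p. 174 lines 40–55)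
"`ℰ₀` is called `I`-semiregular if the part of the semiregularity map `σ_I : Ext²_{X₀}(ℰ₀, ℰ₀) →
∏_{p∈I} H^{p+1}(X₀, Ω^{p−1}_{X₀})` is injective", `σ = Tr(∗ · exp(−At ℰ₀))` (Def. 4.1, p. 166); combined with
the last paragraph of Bloch's proof of (7.4) (p. 65: the algebraicity locus "is contained in a countable union
of closed subvarieties of `S`. Since `U ⊂ T`, it follows that `T = S`") the conclusion holds on the whole
connected base. RENDERING: for every Chern character theory `C`, every smooth projective family `f : 𝒳 ⟶ S`
of relative dimension `n` with `𝒳`, `S` quasi-projective, `S` smooth and irreducible, every `s₀ ∈ S(ℂ)`,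
every FINITE LOCALLY FREE `ℰ₀` on `𝒳_{s₀}` which is `I`-semiregular (`IsISemiregular hE₀ {q | q + 1 ∈ I}`,
`I` a finite set of Chern degrees), and global classes `W_p ∈ H^{2p}(𝒳(ℂ); ℂ)` (`p ∈ I`) of Hodge type
`(p,p)` on every fibre (the horizontal sections `α_p`) with `W_p|_{𝒳_{s₀}} = ch_p(ℰ₀)`: `W_p|_{𝒳_t}` is an
algebraic class for every `p ∈ I` and EVERY `t ∈ S(ℂ)`. Scope: `ℰ₀` finite locally free and untwisted (module
docstring, (R4)–(R7)). Proof: `R^{2p}f_*ℂ` is a local system on all of `S(ℂ)` (Ehresmann, proved in the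
tree); the transports of `ch_p(ℰ₀) = W_p|_{𝒳_{s₀}}` are the restrictions `W_p|_{𝒳_t}`
(`transportFun_map_fiberι`), hence of type `(p,p)`; Thm. 5.1 gives an open `W' ∋ s₀` on whose path component
of `s₀` (open: `S(ℂ)` is a manifold) `W_p|_{𝒳_t}` is algebraic; Bloch's Baire argument
(`charlesSchnell_algebraicityLocus_iUnion_closed.forall_mem_algebraicClasses_of_isOpen`, from
`BlochSemiregularSpreadGlobal.lean`) spreads this to every `t`. Trust base: `hBF`, `hCS`.
[cite: BuchweitzFlenner2003, §5 Thm. 5.1 pp. 174–175, §5 (I-semiregular) p. 174, Def. 4.1 p. 166]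
[cite: Bloch1972Semiregularity, proof of Thm. (7.4), last paragraph, p. 65]
[cite: CharlesSchnell2014Notes, Prop. 11.3.11 (proof)] -/
theorem semiregular_deforms (hBF : BuchweitzFlenner2003_variationalHodge_ISemiregular)
    (hCS : charlesSchnell_algebraicityLocus_iUnion_closed) (C : ChernCharacterBetti)
    -- "a deformation of a compact complex algebraic manifold over a smooth germ", globalised: a smooth
    -- projective family over a smooth irreducible quasi-projective base
    {𝒳 S : SchemeOver ℂ} (f : 𝒳 ⟶ S) (hf : IsSmoothProjectiveFamily f n) (h𝒳 : IsQuasiProjectiveOver 𝒳)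
    (hS : IsQuasiProjectiveOver S) (hSm : AlgebraicGeometry.Smooth S.hom) [IrreducibleSpace S.left]
    (s₀ : ComplexPoints S)
    -- "an `I`-semiregular sheaf `ℰ₀` on `X₀`" (finite locally free; Chern degrees `I` ↔ form degrees)
    (E₀ : (fiberOver f s₀).left.Modules) (hE₀ : IsFiniteLocallyFree E₀) (I : Finset ℕ)
    (hsr : IsISemiregular hE₀ {q | q + 1 ∈ I})
    -- "`(α_p)_{p ∈ I}` a horizontal section", of type `(p,p)` on every fibre, "`α_p(0) = ch_p(ℰ₀)`"
    (W : (p : ℕ) → complexBetti 𝒳 (2 * p))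
    (hW : ∀ p ∈ I, ∀ s : ComplexPoints S,
      IsOfHodgeType n (fiberOver f s) (2 * p) p p (Res[f, s, 2 * p, W p]))
    (hW₀ : ∀ p ∈ I, Res[f, s₀, 2 * p, W p] = C.ch (fiberOver f s₀) E₀ p)
    -- "then `α_p(s)` is algebraic" — for EVERY `s`
    {p : ℕ} (hp : p ∈ I) (t : ComplexPoints S) :
    Res[f, t, 2 * p, W p] ∈ algebraicClasses (fiberOver f t) p := by
  classical
  haveI := hSm
  haveI : LocallyOfFiniteType S.hom := hS.locallyOfFiniteType
  haveI : ConnectedSpace (ComplexPoints S) := (ComplexPoints.connectedSpace_iff_holds S).2 inferInstance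
  -- `S(ℂ)` is a topological manifold of dimension `2d`, and `R^k f_* ℂ` is a local system on all of it
  obtain ⟨d, hd⟩ := exists_smoothOfRelativeDimension_of_connectedSpace_complexPoints S
  haveI := hd
  have hU : IsCohomologicallyLocallyTrivialOn f (Set.univ : Set (ComplexPoints S)) :=
    isCohomologicallyLocallyTrivialOn_univ_of_isSmoothProjectiveFamily f d hf hS
  letI := ComplexPoints.chartedSpace S d
  haveI : LocallyPathConnectedSpace (ComplexPoints S) :=
    ChartedSpace.locallyPathConnectedSpace (EuclideanSpace ℝ (Fin (2 * d))) (ComplexPoints S)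
  let s₀' : (Set.univ : Set (ComplexPoints S)) := ⟨s₀, Set.mem_univ s₀⟩
  -- BF's horizontality hypothesis: the transports of `ch_p(ℰ₀)` are the restrictions of `W_p`
  have hHodge : ∀ p' ∈ I, ∀ (t : (Set.univ : Set (ComplexPoints S)))
      (γ : Path.Homotopic.Quotient s₀' t),
      IsOfHodgeType n (fiberOver f t.1) (2 * p') p' p'
        (transportFun f (2 * p') hU γ (C.ch (fiberOver f s₀'.1) E₀ p')) := by
    intro p' hp' t γ
    change IsOfHodgeType n (fiberOver f t.1) (2 * p') p' p'
      (transportFun f (2 * p') hU γ (C.ch (fiberOver f s₀) E₀ p'))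
    rw [← hW₀ p' hp', transportFun_map_fiberι f (2 * p') hU γ (W p')]
    exact hW p' hp' t.1
  obtain ⟨W', hWo, hW'₀, hWU, hW'⟩ := hBF C f n hf hSm hU s₀' E₀ hE₀ I hsr hHodge
  -- algebraic on the (open) path component of `s₀` in `W'`
  have hV : ∀ t ∈ pathComponentIn W' s₀,
      Res[f, t, 2 * p, W p] ∈ algebraicClasses (fiberOver f t) p := by
    intro t ht
    have hj : JoinedIn W' s₀ t := ht
    let γ : Path (⟨s₀, hW'₀⟩ : W') ⟨t, pathComponentIn_subset ht⟩ :=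
      { toFun := fun u ↦ ⟨hj.somePath u, hj.somePath_mem u⟩
        continuous_toFun := hj.somePath.continuous.subtype_mk _
        source' := Subtype.ext hj.somePath.source
        target' := Subtype.ext hj.somePath.target }
    have hmem := hW' p hp ⟨t, pathComponentIn_subset ht⟩ ⟦γ⟧
    have htr : transportFun f (2 * p) (hU.mono hWU hWo) ⟦γ⟧ (C.ch (fiberOver f s₀) E₀ p) =
        Res[f, t, 2 * p, W p] := by
      rw [← hW₀ p hp]
      exact transportFun_map_fiberι f (2 * p) (hU.mono hWU hWo) ⟦γ⟧ (W p)
    change transportFun f (2 * p) (hU.mono hWU hWo) ⟦γ⟧ (C.ch (fiberOver f s₀) E₀ p) ∈ _ at hmem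
    rwa [htr] at hmem
  exact hCS.forall_mem_algebraicClasses_of_isOpen f n p h𝒳 hS hSm hf (W p)
    (hWo.pathComponentIn s₀) ⟨s₀, mem_pathComponentIn_self hW'₀⟩ hV t

end BuchweitzFlenner2003

end Summit.Ventures.HSemireg

end
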